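import Mathlib
import HarnessLib
import Summits.RiemannHypothesis.RiemannHypothesis.Theorems.IntegerScrewDeathIdentity

/-!
# Route `IntegerScrew` — THE BIRTH IDENTITY and THE EXACT DECOMPOSITION 16.4 of `(𝒜_D − ∂_u)h̃` in the kernel
# (CONTINUUM-LIMIT 16.4 (iii); PIVOT-LAW 13.44)

With the death identity (`IntegerScrewDeathIdentity`: deaths − ∂_uh̃ = −I(u,ρ)Π) the exact decomposition
CONTINUUM-LIMIT 16.4 of the generator defect of `h̃(u;x) = K(u,ρ_x)Π(u;x)` reduces to the BIRTHS
`Σ_{n ≤ M/x} Λ(n)/(nL)·(h̃(u;xn) − h̃(u;x))`.  Reindexing the prime powers `n = q^a ≤ M/x` by `(q, a)`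
(`sum_Icc_vonMangoldt_mul`) and applying the move rules (`hTilde_mul_new`: `h̃(xq^a) = K(u,ρ−aθ_q)Πφ(θ_q)` for
`q ∤ x`; `hTilde_mul_present`: `= K(u,ρ−aθ_p)Π` for `p ∣ x`) gives

  `births = Π(u;x) · Σ_{q ≤ M/x prime} Σ_{a ≥ 1, q^a ≤ M/x} (log q/(q^aL))·[K(u,ρ−aθ_q)·χ_q − K(u,ρ)]`,
  `χ_q = 1` if `q ∣ x`, `= φ(θ_q) = 1 − e^{−uθ_q}` if `q ∤ x`  (`births_eq`)

— the terms `q ∤ x, a = 1` are 16.4's `Σ_{q∤x, qx≤M}(log q/(qL))F(θ_q) = E_Mert + I − C_px`, `q ∤ x, a ≥ 2` are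
`B₂`, `q ∣ x` are `B_rep` — and therefore **the decomposition itself** (`generator_sub_deriv_eq`):

  `births + deaths − ∂_u h̃ = Π·[Σ_{q,a}(…)] − I(u,ρ_x)·Π`   (= `Π[E_Mert − C_px + B₂ + B_rep]` of 16.4).

What THEOREM C♯'s lower bound still needs outside the kernel is 16.5 alone: the Rosser–Schoenfeld bookkeeping
bounding the bracket from below by `−ε⁻_L K(u,ρ)` (`returnProb_ge_of_sixteen_four`).  RH-free.  Nothing here
bears on the truth of RH.  References: CONTINUUM-LIMIT §16.4, §21.1 (K3) (rh-explicit); M. Suzuki, J. Lond. Math.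
Soc. (2) 108 (2023) 1448–1487 [Suzuki2023].
-/

noncomputable section

-- D-0017: `Summit.<S>.<S>.…` is the designed namespace of a single-problem summit.
set_option linter.dupNamespace false

namespace Summit.RiemannHypothesis.RiemannHypothesis.Theorems.IntegerScrew

open Finset

/-- `Σ_{n ≤ Y} Λ(n)·G(n) = Σ_{q ≤ Y prime} Σ_{a=1}^{log_q Y} log q·G(q^a)`: the von Mangoldt weight keeps the
prime powers `q^a ≤ Y`, indexed by (prime, exponent). -/
theorem sum_Icc_vonMangoldt_mul (Y : ℕ) (G : ℕ → ℝ) :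
    ∑ n ∈ Finset.Icc 1 Y, (ArithmeticFunction.vonMangoldt n : ℝ) * G n =
      ∑ q ∈ (Finset.Icc 1 Y).filter Nat.Prime, ∑ a ∈ Finset.Icc 1 (Nat.log q Y), Real.log q * G (q ^ a) := by
  classical
  rcases Nat.eq_zero_or_pos Y with rfl | hY
  · simp
  set S : Finset (Σ _ : ℕ, ℕ) := ((Finset.Icc 1 Y).filter Nat.Prime).sigma fun q => Finset.Icc 1 (Nat.log q Y)
    with hS
  have hinj : ∀ a ∈ S, ∀ a' ∈ S, (fun s : Σ _ : ℕ, ℕ => s.1 ^ s.2) a = (fun s : Σ _ : ℕ, ℕ => s.1 ^ s.2) a' →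
      a = a' := by
    rintro ⟨p, b⟩ ha ⟨q, c⟩ ha' h
    simp only [hS, Finset.mem_sigma, Finset.mem_filter, Finset.mem_Icc] at ha ha'
    have hp : p.Prime := ha.1.2
    have hq : q.Prime := ha'.1.2
    simp only at h
    have hpq : p = q := by
      have h1 := congrArg Nat.minFac h
      rwa [hp.pow_minFac (by omega), hq.pow_minFac (by omega)] at h1
    subst hpq
    have hbc : b = c := Nat.pow_right_injective hp.two_le h
    subst hbc
    rfl
  have himage : S.image (fun s : Σ _ : ℕ, ℕ => s.1 ^ s.2) ⊆ Finset.Icc 1 Y := by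
    intro d hd
    rw [Finset.mem_image] at hd
    obtain ⟨⟨p, b⟩, hs, rfl⟩ := hd
    simp only [hS, Finset.mem_sigma, Finset.mem_filter, Finset.mem_Icc] at hs
    have hp : p.Prime := hs.1.2
    refine Finset.mem_Icc.2 ⟨Nat.one_le_pow _ _ hp.pos, ?_⟩
    exact Nat.pow_le_of_le_log (by omega) hs.2.2
  have hzero : ∀ d ∈ Finset.Icc 1 Y, d ∉ S.image (fun s : Σ _ : ℕ, ℕ => s.1 ^ s.2) →
      (ArithmeticFunction.vonMangoldt d : ℝ) * G d = 0 := by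
    intro d hd hnot
    have hnpp : ¬ IsPrimePow d := by
      intro hpp
      obtain ⟨p, k, hp, hk, rfl⟩ := (isPrimePow_nat_iff d).1 hpp
      apply hnot
      rw [Finset.mem_image]
      refine ⟨⟨p, k⟩, ?_, rfl⟩
      simp only [hS, Finset.mem_sigma, Finset.mem_filter, Finset.mem_Icc]
      have hle : p ^ k ≤ Y := (Finset.mem_Icc.1 hd).2
      refine ⟨⟨⟨hp.pos, (Nat.le_self_pow (by omega) p).trans hle⟩, hp⟩, by omega, ?_⟩
      exact (Nat.le_log_iff_pow_le hp.one_lt (by omega)).2 hle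
    rw [ArithmeticFunction.vonMangoldt_eq_zero_iff.2 hnpp, zero_mul]
  rw [← Finset.sum_subset himage hzero, Finset.sum_image hinj, hS, Finset.sum_sigma]
  refine Finset.sum_congr rfl fun p hp => Finset.sum_congr rfl fun b hb => ?_
  have hpr : p.Prime := (Finset.mem_filter.1 hp).2
  have hb1 : b ≠ 0 := by have := (Finset.mem_Icc.1 hb).1; omega
  simp only
  rw [ArithmeticFunction.vonMangoldt_apply_pow hb1, ArithmeticFunction.vonMangoldt_apply_prime hpr]

/-- The factor by which a birth of `q^a` changes `Π`: `1` if `q ∣ x` already, `φ(θ_q)` if `q` is new. -/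
def birthChi (L u : ℝ) (x q : ℕ) : ℝ :=
  if q ∣ x then 1 else 1 - Real.exp (-(u * (Real.log q / L)))

/-- `h̃(u; x·q^a) = K(u, ρ_x − aθ_q)·Π(u;x)·χ_q` for a prime `q` and `a ≥ 1` (both move types at once). -/
theorem hTilde_mul_prime_pow (L u : ℝ) {x q a : ℕ} (hx : x ≠ 0) (hq : q.Prime) (ha : a ≠ 0) :
    hTilde L u (x * q ^ a) = ccpK u (room L x - a * (Real.log q / L)) * primeProd L u x * birthChi L u x q := by
  unfold birthChi
  by_cases hqx : q ∣ x
  · rw [if_pos hqx, hTilde_mul_present L u hx hq hqx a, mul_one]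
  · rw [if_neg hqx, hTilde_mul_new L u hx hq hqx ha]

/-- **THE BIRTH IDENTITY**: `Σ_{n≤M/x}Λ(n)/(nL)(h̃(u;xn) − h̃(u;x)) = Π(u;x)·Σ_{q≤M/x prime}Σ_{a≤log_q(M/x)}
(log q/(q^aL))·[K(u,ρ_x − aθ_q)χ_q − K(u,ρ_x)]` (16.4 (iii): the new-prime terms, `B₂` and `B_rep`). -/
theorem births_eq (L u : ℝ) {M x : ℕ} (hx : x ≠ 0) :
    ∑ n ∈ Finset.Icc 1 (M / x), (ArithmeticFunction.vonMangoldt n : ℝ) / ((n : ℝ) * L) *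
        (hTilde L u (x * n) - hTilde L u x) =
      primeProd L u x * ∑ q ∈ (Finset.Icc 1 (M / x)).filter Nat.Prime, ∑ a ∈ Finset.Icc 1 (Nat.log q (M / x)),
        Real.log q / (((q : ℝ) ^ a) * L) *
          (ccpK u (room L x - a * (Real.log q / L)) * birthChi L u x q - ccpK u (room L x)) := by
  have h := sum_Icc_vonMangoldt_mul (M / x) (fun n => 1 / ((n : ℝ) * L) * (hTilde L u (x * n) - hTilde L u x))
  have h1 : (∑ n ∈ Finset.Icc 1 (M / x), (ArithmeticFunction.vonMangoldt n : ℝ) / ((n : ℝ) * L) *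
        (hTilde L u (x * n) - hTilde L u x)) =
      ∑ n ∈ Finset.Icc 1 (M / x), (ArithmeticFunction.vonMangoldt n : ℝ) *
        (1 / ((n : ℝ) * L) * (hTilde L u (x * n) - hTilde L u x)) :=
    Finset.sum_congr rfl fun n _ => by ring
  rw [h1, h, Finset.mul_sum]
  refine Finset.sum_congr rfl fun q hq => ?_
  have hqp : q.Prime := (Finset.mem_filter.1 hq).2
  rw [Finset.mul_sum]
  refine Finset.sum_congr rfl fun a ha => ?_
  have ha1 : a ≠ 0 := by have := (Finset.mem_Icc.1 ha).1; omega
  rw [hTilde_mul_prime_pow L u hx hqp ha1]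
  unfold hTilde
  push_cast
  ring

/-- **THE EXACT DECOMPOSITION 16.4** (for `h̃`): for `x ≥ 1`, `u ≠ 0`,
`births + deaths − ∂_u h̃ = Π·Σ_{q,a}(log q/(q^aL))[K(u,ρ−aθ_q)χ_q − K] − I(u,ρ)·Π`
(`= Π[E_Mert − C_px + B₂ + B_rep]` in the notation of CONTINUUM-LIMIT 16.4). -/
theorem generator_sub_deriv_eq (L : ℝ) {u : ℝ} (hu : u ≠ 0) {M x : ℕ} (hx : x ≠ 0) :
    (∑ n ∈ Finset.Icc 1 (M / x), (ArithmeticFunction.vonMangoldt n : ℝ) / ((n : ℝ) * L) *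
        (hTilde L u (x * n) - hTilde L u x)) +
      (∑ d ∈ x.divisors, (ArithmeticFunction.vonMangoldt d : ℝ) / L * (hTilde L u (x / d) - hTilde L u x)) -
        hTildeDeriv L u x =
      primeProd L u x * (∑ q ∈ (Finset.Icc 1 (M / x)).filter Nat.Prime, ∑ a ∈ Finset.Icc 1 (Nat.log q (M / x)),
        Real.log q / (((q : ℝ) ^ a) * L) *
          (ccpK u (room L x - a * (Real.log q / L)) * birthChi L u x q - ccpK u (room L x))) -
        ccpI u (room L x) * primeProd L u x := by
  rw [births_eq L u hx, add_sub_assoc, divisor_deaths_sub_hTildeDeriv L hu hx]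
  ring

/-! ## The same for `h′ = h̃·W` (the upper bound's comparison function): `N_birth` enters through `χ′` -/

/-- The factor by which a birth of `q^a` changes `Π·W`: `1` if `q ∣ x`, `φ(θ_q)·q/(q−1)` if `q` is new. -/
def birthChiW (L u : ℝ) (x q : ℕ) : ℝ :=
  if q ∣ x then 1 else (1 - Real.exp (-(u * (Real.log q / L)))) * ((q : ℝ) / ((q : ℝ) - 1))

/-- `h′(u; x·q^a) = K(u, ρ_x − aθ_q)·Π(u;x)·W(x)·χ′_q` for a prime `q` and `a ≥ 1`. -/
theorem hPrime_mul_prime_pow (L u : ℝ) {x q a : ℕ} (hx : x ≠ 0) (hq : q.Prime) (ha : a ≠ 0) :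
    hPrime L u (x * q ^ a) =
      ccpK u (room L x - a * (Real.log q / L)) * primeProd L u x * wProd x * birthChiW L u x q := by
  unfold birthChiW
  by_cases hqx : q ∣ x
  · rw [if_pos hqx, hPrime_mul_present L u hx hq hqx a, mul_one]
  · rw [if_neg hqx, hPrime_mul_new L u hx hq hqx ha]
    ring

/-- **THE BIRTH IDENTITY for `h′`**. -/
theorem births_eq_hPrime (L u : ℝ) {M x : ℕ} (hx : x ≠ 0) :
    ∑ n ∈ Finset.Icc 1 (M / x), (ArithmeticFunction.vonMangoldt n : ℝ) / ((n : ℝ) * L) *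
        (hPrime L u (x * n) - hPrime L u x) =
      primeProd L u x * wProd x *
        ∑ q ∈ (Finset.Icc 1 (M / x)).filter Nat.Prime, ∑ a ∈ Finset.Icc 1 (Nat.log q (M / x)),
          Real.log q / (((q : ℝ) ^ a) * L) *
            (ccpK u (room L x - a * (Real.log q / L)) * birthChiW L u x q - ccpK u (room L x)) := by
  have h := sum_Icc_vonMangoldt_mul (M / x) (fun n => 1 / ((n : ℝ) * L) * (hPrime L u (x * n) - hPrime L u x))
  have h1 : (∑ n ∈ Finset.Icc 1 (M / x), (ArithmeticFunction.vonMangoldt n : ℝ) / ((n : ℝ) * L) *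
        (hPrime L u (x * n) - hPrime L u x)) =
      ∑ n ∈ Finset.Icc 1 (M / x), (ArithmeticFunction.vonMangoldt n : ℝ) *
        (1 / ((n : ℝ) * L) * (hPrime L u (x * n) - hPrime L u x)) :=
    Finset.sum_congr rfl fun n _ => by ring
  rw [h1, h, Finset.mul_sum]
  refine Finset.sum_congr rfl fun q hq => ?_
  have hqp : q.Prime := (Finset.mem_filter.1 hq).2
  rw [Finset.mul_sum]
  refine Finset.sum_congr rfl fun a ha => ?_
  have ha1 : a ≠ 0 := by have := (Finset.mem_Icc.1 ha).1; omega
  rw [hPrime_mul_prime_pow L u hx hqp ha1]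
  unfold hPrime hTilde
  push_cast
  ring

/-- **THE EXACT DECOMPOSITION 16.4 for `h′`**: `births + deaths − ∂_u h′ = Π·W·Σ_{q,a}(log q/(q^aL))
[K(u,ρ−aθ_q)χ′_q − K] − W·[I(u,ρ)Π + Σ_{p∣x}(θ_p/p)h̃(u;x/p^{v_p})]` (= `WΠ[E_Mert − C_px + B₂ + B_rep + N_birth
− N_death]` of CONTINUUM-LIMIT 16.4). -/
theorem generator_sub_deriv_eq_hPrime (L : ℝ) {u : ℝ} (hu : u ≠ 0) {M x : ℕ} (hx : x ≠ 0) :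
    (∑ n ∈ Finset.Icc 1 (M / x), (ArithmeticFunction.vonMangoldt n : ℝ) / ((n : ℝ) * L) *
        (hPrime L u (x * n) - hPrime L u x)) +
      (∑ d ∈ x.divisors, (ArithmeticFunction.vonMangoldt d : ℝ) / L * (hPrime L u (x / d) - hPrime L u x)) -
        hPrimeDeriv L u x =
      primeProd L u x * wProd x *
          (∑ q ∈ (Finset.Icc 1 (M / x)).filter Nat.Prime, ∑ a ∈ Finset.Icc 1 (Nat.log q (M / x)),
            Real.log q / (((q : ℝ) ^ a) * L) *
              (ccpK u (room L x - a * (Real.log q / L)) * birthChiW L u x q - ccpK u (room L x))) -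
        wProd x * (ccpI u (room L x) * primeProd L u x +
          ∑ p ∈ x.primeFactors, (Real.log p / L) / p * hTilde L u (x / p ^ x.factorization p)) := by
  rw [births_eq_hPrime L u hx, add_sub_assoc, divisor_deaths_sub_hPrimeDeriv L hu hx]
  ring

end Summit.RiemannHypothesis.RiemannHypothesis.Theorems.IntegerScrew

end
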